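import Summits.CriticalPhenomena.PercolationContinuityZ3.Theorems.Transplant.FKConnectivityAllQAntipodalRootFormGeneral
import Summits.CriticalPhenomena.PercolationContinuityZ3.Theorems.Transplant.FKConnectivityAllQAntipodalLevel4

/-!
# Connectivity correlation inequalities for `φ_{w,q}`, every `q > 0` — file 64d: **`maj₃⁺` AT AN ARBITRARY POSITION** (the `maj₃` rays of the odd cone,
# root-free form)

Support file (`--supports stmt-CriticalPhenomena-4575`), FK sub-lane `prim-bschramm-fk-2` (gen 29); builds on p205010 (kernel theorem,
internal audit signed; external expert review pending).  No definitions, no named facts, no sorries; standard axioms.  Memo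
FROM-fk-2-g29-BRIDGE.md §14 (master-file plan, rays 9–12).

File 61z (`FK.RootForm.maj3_levels_le_nonpos_of_isTTSP`) proves the `q`-free majority inequality with the root edge `x = ab` as one of the three
majority edges.  The level-4 assembly also meets `maj₃(y,z,w)` with the root free, contracted or deleted; Duffin re-rooting
(`FK.IsTTSP.reroot_erase`) moves the root onto a majority edge without touching the antipodal sum.  Hence the root-free form
`apPsiC_levels_le_maj3Set_nonpos_of_isTTSP`: any three distinct edges `e₁, e₂, e₃` of `H = E ∪ {st}`, any cell `N` (free) / `C` (contracted) of `H`
off them.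
[cite: Grimmett2006, §3.8 Thm. (3.90) (pp. 61–62); §3.9 (pp. 63–64)] [cite: Wagner2006, Thm. 5.8(d), §5.3]
-/

noncomputable section

namespace Summit.CriticalPhenomena.PercolationContinuityZ3.Theorems

namespace FK

open SimpleGraph Literature.Probability.LatticeModels Literature.Probability.Percolation
open scoped Classical

variable {V : Type*} [Fintype V]

/-- **`maj₃⁺` at an arbitrary position, partial sums by cluster level.**  `E` TTSP between `s, t`, `st ∉ E`, `H = E ∪ {st}`; `e₁, e₂, e₃ ∈ H`
distinct; `N, C ⊆ H \ {e₁,e₂,e₃}` disjoint (edges of `H` outside `N ∪ C ∪ {e₁,e₂,e₃}` are deleted); `g` increasing, blind to `e₁, e₂, e₃`.  Then for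
every level cut-off `J`, with `M' = {e₁,e₂,e₃} ∪ N` and `maj₃ X = 1{two of e₁,e₂,e₃ lie in X}`:
`∑_{γ ⊆ M' : k(γ∪C)+k((M'\γ)∪C) ≤ J} (maj₃(γ∪C) − maj₃((M'\γ)∪C))·(g(γ∪C) − g((M'\γ)∪C)) ≤ 0`.
Proof: re-root `H` at `e₁` and apply file 61z. [cite: Grimmett2006, §3.8 Thm. (3.90) (pp. 61–62); §3.9 (pp. 63–64)]
[cite: Wagner2006, Thm. 5.8(d), §5.3] -/
theorem apPsiC_levels_le_maj3Set_nonpos_of_isTTSP {E : Finset (Sym2 V)} {s t : V} (hE : IsTTSP E s t) (hst : s(s, t) ∉ E)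
    {e₁ e₂ e₃ : Sym2 V} (h₁ : e₁ ∈ insert s(s, t) E) (h₂ : e₂ ∈ insert s(s, t) E) (h₃ : e₃ ∈ insert s(s, t) E)
    (h₁₂ : e₁ ≠ e₂) (h₁₃ : e₁ ≠ e₃) (h₂₃ : e₂ ≠ e₃) {N C : Finset (Sym2 V)}
    (hN : N ⊆ (((insert s(s, t) E).erase e₁).erase e₂).erase e₃) (hC : C ⊆ (((insert s(s, t) E).erase e₁).erase e₂).erase e₃)
    (hNC : Disjoint N C) {g : Finset (Sym2 V) → ℝ} (hg₁ : ∀ A : Finset (Sym2 V), g (insert e₁ A) = g A)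
    (hg₂ : ∀ A : Finset (Sym2 V), g (insert e₂ A) = g A) (hg₃ : ∀ A : Finset (Sym2 V), g (insert e₃ A) = g A)
    (hmono : ∀ ⦃X Y : Finset (Sym2 V)⦄, X ⊆ Y → g X ≤ g Y) (J : ℕ) :
    ∑ γ ∈ (insert e₁ (insert e₂ (insert e₃ N))).powerset with apExpC (insert e₁ (insert e₂ (insert e₃ N))) C γ ≤ J,
        ((((fun X : Finset (Sym2 V) => if (e₁ ∈ X ∧ e₂ ∈ X) ∨ (e₁ ∈ X ∧ e₃ ∈ X) ∨ (e₂ ∈ X ∧ e₃ ∈ X) then (1 : ℝ) else 0) (γ ∪ C)) -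
            ((fun X : Finset (Sym2 V) => if (e₁ ∈ X ∧ e₂ ∈ X) ∨ (e₁ ∈ X ∧ e₃ ∈ X) ∨ (e₂ ∈ X ∧ e₃ ∈ X) then (1 : ℝ) else 0)
                ((insert e₁ (insert e₂ (insert e₃ N))) \ γ ∪ C))) *
          (g (γ ∪ C) - g ((insert e₁ (insert e₂ (insert e₃ N))) \ γ ∪ C))) ≤ 0 := by
  induction e₁ using Sym2.ind with
  | h a₁ b₁ =>
  induction e₂ using Sym2.ind with
  | h a₂ b₂ =>
  induction e₃ using Sym2.ind with
  | h a₃ b₃ =>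
  -- re-root `H` at `e₁`
  have hR : IsTTSP ((insert s(s, t) E).erase s(a₁, b₁)) a₁ b₁ :=
    hE.reroot_erase h₁ (insert_ne_singleton_of_isTTSP hE hst _)
  have hx' : s(a₁, b₁) ∉ (insert s(s, t) E).erase s(a₁, b₁) := Finset.notMem_erase _ _
  have hy' : s(a₂, b₂) ∈ (insert s(s, t) E).erase s(a₁, b₁) := Finset.mem_erase.2 ⟨fun h => h₁₂ h.symm, h₂⟩
  have hz' : s(a₃, b₃) ∈ (insert s(s, t) E).erase s(a₁, b₁) := Finset.mem_erase.2 ⟨fun h => h₁₃ h.symm, h₃⟩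
  exact RootForm.maj3_levels_le_nonpos_of_isTTSP hR hx' hy' hz' h₂₃ hN hC hNC hg₁ hg₂ hg₃ hmono J

end FK

end Summit.CriticalPhenomena.PercolationContinuityZ3.Theorems
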